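import Literature.Topology.FourManifolds.CappellShanesonDeltaMoveProofs
import Literature.Topology.FourManifolds.GompfFramedTwistHolds
import Literature.Topology.FourManifolds.CappellShanesonAkbulutKirbyProofs
import Literature.Topology.FourManifolds.GompfFramedSpheresHolds
import Literature.Topology.FourManifolds.SPC4HandlesLemma2FromH1
import Literature.Topology.FourManifolds.HandleRealise
import HarnessLib

/-!
# Discharged facts: Gompf 2010 on Cappell–Shaneson spheres (Δ-moves, Akbulut–Kirby framings) and the
# one-handlebody form of Laudenbach–Poénaru's Lemma 2 hold

Three named facts of the smooth-Poincaré-in-dimension-four cluster were reduced in the tree to leaves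
that have since been proved, the reductions' docstrings announcing "`…_holds` is this theorem applied
to `…_holds`" once the leaf lands:

* `gompf2010_deltaMove_holds` — Gompf, *More Cappell–Shaneson spheres are standard*, AGT 10 (2010),
  Thm. 2.1 with §3 (Δ-moves on matrices in standard form preserve the diffeomorphism type of the
  Cappell–Shaneson sphere), by `gompf2010_deltaMove_of_framedTwist'`
  (`CappellShanesonDeltaMoveProofs.lean`) applied to the framed Theorem 2.1
  `gompf2010_framedTwist_holds` (`GompfFramedTwistHolds.lean`);
* `gompf2010_akbulutKirby_framings_holds` — Gompf 2010, Thm. 4.3 in the tree's framing-free form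
  (the two framings give diffeomorphic Cappell–Shaneson spheres), by
  `gompf2010_akbulutKirby_framings_of_thm43` (`CappellShanesonAkbulutKirbyProofs.lean`) applied to
  `gompf2010_thm43_holds` (`GompfFramedSpheresHolds.lean`);
* `exists_oneHandlebody_laudenbachPoenaru_exists_diffeoExtends_mapOfEq_eq_holds` —
  Laudenbach–Poénaru 1972, §2, Lemma 2 in one-handlebody form, by
  `exists_oneHandlebody_laudenbachPoenaru_exists_diffeoExtends_mapOfEq_eq_of_forall`
  (`SPC4HandlesLemma2FromH1.lean`) applied to
  `laudenbachPoenaru_exists_diffeoExtends_mapOfEq_eq_holds` (`HandleRealise.lean`).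

No statement is changed; no definition, no new named fact (D-0026).

## References

* R. E. Gompf, *More Cappell–Shaneson spheres are standard*, Algebr. Geom. Topol. 10 (2010)
  1665–1681: Thm. 2.1, §3, Thm. 4.3. [GompfAGT2010]
* F. Laudenbach, V. Poénaru, *A note on 4-dimensional handlebodies*, Bull. Soc. Math. France 100
  (1972) 337–344, §2 Lemma 2 (p. 339). [LaudenbachPoenaruBSMF1972]
-/

noncomputable section

namespace Literature.Topology.FourManifolds

universe u v

/-- **Gompf 2010, Thm. 2.1 with §3 (Δ-moves) — the named fact `gompf2010_deltaMove` holds**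
(`gompf2010_deltaMove_of_framedTwist'` applied to `gompf2010_framedTwist_holds`).
[cite: GompfAGT2010, Thm 2.1 and §3 (Δ-moves on matrices in standard form)] -/
theorem gompf2010_deltaMove_holds : gompf2010_deltaMove.{u} :=
  gompf2010_deltaMove_of_framedTwist' gompf2010_framedTwist_holds

/-- **Gompf 2010, Thm. 4.3 (both Akbulut–Kirby framings give diffeomorphic Cappell–Shaneson
spheres) — the named fact `gompf2010_akbulutKirby_framings` holds**
(`gompf2010_akbulutKirby_framings_of_thm43` applied to `gompf2010_thm43_holds`).
[cite: GompfAGT2010, Thm 4.3] -/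
theorem gompf2010_akbulutKirby_framings_holds : gompf2010_akbulutKirby_framings.{u, v} :=
  gompf2010_akbulutKirby_framings_of_thm43 gompf2010_thm43_holds

/-- **Laudenbach–Poénaru 1972, §2 Lemma 2, one-handlebody form — the named fact
`exists_oneHandlebody_laudenbachPoenaru_exists_diffeoExtends_mapOfEq_eq` holds**
(`exists_oneHandlebody_laudenbachPoenaru_exists_diffeoExtends_mapOfEq_eq_of_forall` applied to
`laudenbachPoenaru_exists_diffeoExtends_mapOfEq_eq_holds`).
[cite: LaudenbachPoenaruBSMF1972, §2, Lemma 2 (p. 339)] -/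
theorem exists_oneHandlebody_laudenbachPoenaru_exists_diffeoExtends_mapOfEq_eq_holds :
    exists_oneHandlebody_laudenbachPoenaru_exists_diffeoExtends_mapOfEq_eq.{u} :=
  exists_oneHandlebody_laudenbachPoenaru_exists_diffeoExtends_mapOfEq_eq_of_forall
    laudenbachPoenaru_exists_diffeoExtends_mapOfEq_eq_holds

end Literature.Topology.FourManifolds

end
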